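import Summits.ABC.IUTFork.Joshi.HodgeTheatersJoshi
import HarnessLib

/-!
# Joshi, *Arithmetic Teichmüller spaces III* §10.11, Thm. 10.11.5.1 — the GLOBAL component «isomorphic (realified) Frobenioids
# `Frob(arith(L_mod)_{y̲₁})^ℝ ≃ Frob(arith(L_mod)_{y̲₂})^ℝ`» DERIVED for value-constructed data under placewise equivalence of the
# absolute values (the dilatation shape of Prop. 10.3.3) — proof-only companion of `Joshi/HodgeTheatersJoshi.lean`

Record file of the abc-iut cell, branch E (rung LADDER-ABC:A2.E; seat abc-iut-E-t32, slot T-34b = [J-III] §10.11; a DERIVABLE row of this seat's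
own `Joshi/HodgeTheatersJoshi.lean`). Source and framing as there: K. Joshi, arXiv:2401.13508 **v4**, bib `Joshi2024ATS3`, locators «p.N l.M» of
the cell's PDF-page render; UNREFEREED and disputed [Mochizuki2024JoshiReport]; typed ≠ proved ≠ endorsed; no side taken; no Cor. 3.12
vocabulary (E-PLAN R14).

WHAT IS PROVED. Thm. 10.11.5.1 (p.141 l.1–3) asserts that the Hodge theaters `HT(hol(X/L′))_y = ({Frob^temp(…)}_v, Frob(arith(L_mod)_{y̲})^ℝ)` of
any two holomorphoids are isomorphic; its proof (p.141 l.14–25) argues place by place «a non-canonical isomorphism between such data provided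
by any two holomorphoids». For the GLOBAL constituent, when `Frob(arith(L)_y)^ℝ` is the realified Frobenioid CONSTRUCTED from residue-field values
(`ArithmeticoidAbsDatum.frobArithR`: `Φ^ℝ = ∏_v (0,1] ⊆ ∏_v ℝ^×`, `x ↦ (|ι_v x|_{K_{y_v}})_v`, [ATS II½ Def. 5.14.2, §5.16]), this file PROVES:
if at every place `v` the two absolute values `|ι_v(−)|_{K_{y₁,v}}`, `|ι_v(−)|_{K_{y₂,v}}` on `L` are EQUIVALENT (Mathlib `AbsoluteValue.IsEquiv`,
i.e. `|−|₂ = |−|₁^{c_v}` with `c_v > 0` — exactly the relation between two untilts' valuations in Prop. 10.3.3 (1) / [ATS II½ (5.3.3)] «the two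
valuations … on `L_v` are equivalent», and the DILATATION of [ATS I], seat E-t1's `UntiltPoints.IsDilatation`), then
`Frob(arith(L)_{y₁})^ℝ ≅ Frob(arith(L)_{y₂})^ℝ` as elementary Frobenioids (seat E-t34's `ElementaryFrobenioid.Iso`: on `Φ^gp = ∏_v ℝ^×` the
placewise signed power `r ↦ r·|r|^{c_v − 1}` (`Frob.unitRpow`), on `Φ^ℝ` its restriction, on `B = L^*` the identity) —
`ArithmeticoidAbsDatum.frobArithR_isIso_of_isEquiv`, and hence the global half of `HodgeTheatersIsomorphic` for any Hodge-theater datum whose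
realified Frobenioids are so constructed (`HodgeTheaterDatum.glob_iso_of_isEquiv`). The LOCAL half (tempered Frobenioids, [André 2003b]) and the
equivalence hypothesis itself remain Joshi's claims; nothing here asserts them. As in Prop. 10.3.3 (2), such an isomorphism is NOT compatible
with degrees unless all `c_v = 1` (seat E-t32's `Frob.prop1033_2_of_ne`, seat E-t34's `FrobenioidsJoshiRescaling`). [claim: Joshi2024ATS3, status: disputed]
-/

noncomputable section

open Function

namespace Summit.ABC.IUTFork.Joshi.ATS3

namespace Frob

/-- The SIGNED POWER `r ↦ r·|r|^{c−1}` on `ℝ^×` (`= r^c` for `r > 0`): a homomorphism for every real `c` — the map realising, on value groups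
inside `ℝ^×`, the passage `|−| ↦ |−|^c` between equivalent absolute values (Prop. 10.3.3 (1); [ATS II½ (5.3.3)]). [folklore] -/
def unitRpow (c : ℝ) : ℝˣ →* ℝˣ where
  toFun r := Units.mk0 ((r : ℝ) * |(r : ℝ)| ^ (c - 1))
    (mul_ne_zero r.ne_zero (Real.rpow_pos_of_pos (abs_pos.2 r.ne_zero) _).ne')
  map_one' := Units.ext (by simp)
  map_mul' r s := Units.ext (by
    simp only [Units.val_mk0, Units.val_mul, abs_mul]
    rw [Real.mul_rpow (abs_nonneg _) (abs_nonneg _)]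
    ring)

/-- Value of the signed power. [folklore] -/
@[simp] theorem val_unitRpow (c : ℝ) (r : ℝˣ) : (unitRpow c r : ℝ) = (r : ℝ) * |(r : ℝ)| ^ (c - 1) := rfl

/-- On positive units the signed power is `r ↦ r^c`. [folklore] -/
theorem val_unitRpow_of_pos (c : ℝ) {r : ℝˣ} (hr : 0 < (r : ℝ)) : (unitRpow c r : ℝ) = (r : ℝ) ^ c := by
  rw [val_unitRpow, abs_of_pos hr]
  conv_rhs => rw [show c = 1 + (c - 1) by ring, Real.rpow_add hr, Real.rpow_one]

/-- `unitRpow 1 = id`. [folklore] -/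
theorem unitRpow_one (r : ℝˣ) : unitRpow 1 r = r := Units.ext (by simp)

/-- Signed powers compose by multiplying exponents. [folklore] -/
theorem unitRpow_unitRpow (c d : ℝ) (r : ℝˣ) : unitRpow d (unitRpow c r) = unitRpow (c * d) r := by
  apply Units.ext
  have h0 : 0 < |(r : ℝ)| := abs_pos.2 r.ne_zero
  have h1 : |((r : ℝ) * |(r : ℝ)| ^ (c - 1))| = |(r : ℝ)| ^ c := by
    rw [abs_mul, abs_of_pos (Real.rpow_pos_of_pos h0 _)]
    conv_rhs => rw [show c = 1 + (c - 1) by ring, Real.rpow_add h0, Real.rpow_one]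
  simp only [val_unitRpow]
  rw [h1, ← Real.rpow_mul h0.le, mul_assoc, ← Real.rpow_add h0, show c - 1 + c * (d - 1) = c * d - 1 by ring]

/-- The signed power with exponent `c ≠ 0` is an automorphism of `ℝ^×` (inverse exponent `c⁻¹`). [folklore] -/
def unitRpowEquiv (c : ℝ) (hc : c ≠ 0) : ℝˣ ≃* ℝˣ where
  toFun := unitRpow c
  invFun := unitRpow c⁻¹
  left_inv r := by rw [unitRpow_unitRpow, mul_inv_cancel₀ hc, unitRpow_one]
  right_inv r := by rw [unitRpow_unitRpow, inv_mul_cancel₀ hc, unitRpow_one]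
  map_mul' := map_mul _

/-- `unitRpowEquiv` acts as `unitRpow`. [folklore] -/
@[simp] theorem unitRpowEquiv_apply (c : ℝ) (hc : c ≠ 0) (r : ℝˣ) : unitRpowEquiv c hc r = unitRpow c r := rfl

/-- Its inverse acts as `unitRpow c⁻¹`. [folklore] -/
@[simp] theorem unitRpowEquiv_symm_apply (c : ℝ) (hc : c ≠ 0) (r : ℝˣ) : (unitRpowEquiv c hc).symm r = unitRpow c⁻¹ r := rfl

/-- A positive exponent keeps values in `(0,1]` inside `(0,1]` (the realified divisor monoid is preserved). [folklore] -/
theorem unitRpow_mem_unitInterval {c : ℝ} (hc : 0 < c) {r : ℝˣ} (h0 : 0 < (r : ℝ)) (h1 : (r : ℝ) ≤ 1) :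
    0 < (unitRpow c r : ℝ) ∧ (unitRpow c r : ℝ) ≤ 1 := by
  rw [val_unitRpow_of_pos c h0]
  exact ⟨Real.rpow_pos_of_pos h0 _, Real.rpow_le_one h0.le h1 hc.le⟩

end Frob

/-- Restriction of an automorphism of `∏_v ℝ^×` that preserves the realified divisor monoid `∏_v (0,1]` (in both directions) to an
automorphism of that monoid. [folklore] -/
def realDivMonoidRestrict {Pl : Type} (e : (Pl → ℝˣ) ≃* (Pl → ℝˣ)) (he : ∀ r, r ∈ realDivMonoid Pl → e r ∈ realDivMonoid Pl)
    (he' : ∀ r, r ∈ realDivMonoid Pl → e.symm r ∈ realDivMonoid Pl) : realDivMonoid Pl ≃* realDivMonoid Pl where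
  toFun r := ⟨e r.1, he _ r.2⟩
  invFun r := ⟨e.symm r.1, he' _ r.2⟩
  left_inv r := Subtype.ext (e.symm_apply_apply _)
  right_inv r := Subtype.ext (e.apply_symm_apply _)
  map_mul' r s := Subtype.ext (by simp)

namespace ArithmeticoidAbsDatum

variable {L : Type} [Field L] {Pl : Type} {Pt : Pl → Type} {K : ∀ v, Pt v → Type} [∀ v y, Field (K v y)]
  (A : ArithmeticoidAbsDatum L Pl Pt K)

/-- **Thm. 10.11.5.1, GLOBAL component, DERIVED for value-constructed realified Frobenioids**: if at every place the absolute values of `L`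
read in the two arithmeticoids are equivalent (`|−|₂ = |−|₁^{c_v}`, `c_v > 0` — the relation of Prop. 10.3.3 (1) / [ATS II½ (5.3.3)]), then
`Frob(arith(L)_{y₁})^ℝ ≅ Frob(arith(L)_{y₂})^ℝ`: on `∏_v ℝ^×` the placewise signed powers, on `∏_v (0,1]` their restriction, on `L^*` the
identity. (The equivalence hypothesis is Joshi's to supply; nothing asserts it.) [claim: Joshi2024ATS3, status: disputed] -/
theorem frobArithR_isIso_of_isEquiv {y₁ y₂ : ∀ v, Pt v} (h : ∀ v, (A.absAt y₁ v).IsEquiv (A.absAt y₂ v)) :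
    (A.frobArithR y₁).IsIso (A.frobArithR y₂) := by
  choose c hc hceq using fun v => AbsoluteValue.isEquiv_iff_exists_rpow_eq.1 (h v)
  let e : (Pl → ℝˣ) ≃* (Pl → ℝˣ) := MulEquiv.piCongrRight fun v => Frob.unitRpowEquiv (c v) (hc v).ne'
  have he : ∀ r, r ∈ realDivMonoid Pl → e r ∈ realDivMonoid Pl := fun r hr v => by
    simp only [e, MulEquiv.piCongrRight_apply, Frob.unitRpowEquiv_apply]
    exact Frob.unitRpow_mem_unitInterval (hc v) (hr v).1 (hr v).2
  have he' : ∀ r, r ∈ realDivMonoid Pl → e.symm r ∈ realDivMonoid Pl := fun r hr v => by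
    simp only [e, MulEquiv.piCongrRight_symm, MulEquiv.piCongrRight_apply, Frob.unitRpowEquiv_symm_apply]
    exact Frob.unitRpow_mem_unitInterval (inv_pos.2 (hc v)) (hr v).1 (hr v).2
  refine ⟨{ φ := realDivMonoidRestrict e he he', γ := e, β := MulEquiv.refl _, toGp_comm := fun _ => rfl, div_comm := ?_ }⟩
  intro x
  funext v
  apply Units.ext
  have hx : 0 < ((Frob.absUnits (A.absAt y₁ v) x : ℝˣ) : ℝ) := by
    rw [Frob.val_absUnits]; exact (A.absAt y₁ v).pos x.ne_zero
  change (Frob.unitRpow (c v) (Frob.absUnits (A.absAt y₁ v) x) : ℝ) = (Frob.absUnits (A.absAt y₂ v) x : ℝ)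
  rw [Frob.val_unitRpow_of_pos _ hx, Frob.val_absUnits, Frob.val_absUnits, ← hceq v]

end ArithmeticoidAbsDatum

namespace HodgeTheaterDatum

variable {M : ModuliDescentDatum} {FT : Type 1} (𝔇 : HodgeTheaterDatum M FT) {Lmod : Type} [Field Lmod] {K : ∀ v, M.Ymod v → Type}
  [∀ v y, Field (K v y)]

/-- **Thm. 10.11.5.1, GLOBAL half for value-constructed Hodge-theater data**: when the datum's realified Frobenioids `Frob(arith(L_mod)_{y̲})^ℝ`
ARE the value constructions of an `ArithmeticoidAbsDatum` on the `L_mod` side, two holomorphoids whose descended arithmeticoids read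
placewise-equivalent absolute values on `L_mod` have Hodge theaters with ISOMORPHIC global constituents. (The local constituents — tempered
Frobenioids, [André 2003b] — are the other half of `HodgeTheatersIsomorphic` and stay a claim.) [claim: Joshi2024ATS3, status: disputed] -/
theorem glob_iso_of_isEquiv (A : ArithmeticoidAbsDatum Lmod M.Vmod M.Ymod K) (hA : 𝔇.frobArithR = A.frobArithR) (h₁ h₂ : 𝔇.Hol)
    (h : ∀ v, (A.absAt (𝔇.moduliOfHol h₁) v).IsEquiv (A.absAt (𝔇.moduliOfHol h₂) v)) :
    Nonempty ((𝔇.hodgeTheaterOf h₁).glob.Iso (𝔇.hodgeTheaterOf h₂).glob) := by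
  change Nonempty ((𝔇.frobArithR (𝔇.moduliOfHol h₁)).Iso (𝔇.frobArithR (𝔇.moduliOfHol h₂)))
  rw [hA]
  exact A.frobArithR_isIso_of_isEquiv h

end HodgeTheaterDatum

end Summit.ABC.IUTFork.Joshi.ATS3
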